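import Summits.QuantumFields.YangMills.Theorems.BalabanLadderIRAfOnsetSliceSums

/-!
# Crux `IR` (stmt-QuantumFields-19354), line `af-pincer`, stub `stub_afOnsetUc : AFToOnsetUKPc` (X-side):
# Schwartz tails of any unit and the wrap-around pairs of the box

Fourth file of the chain `…AfOnsetRiemannSums → …AfOnsetSliceSums → …AfOnsetDoubleSums / …AfOnsetTails → IR/AfPincerUcXCov`
(seat ym-19354-afpincer-s2, generation 2).  For `F, G : ℝ⁴ → ℝ` with the cubic bound `|·(u)| ≤ C |u 0|³ (1+‖u‖)⁻¹⁰`: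

* `sum_abs_smul_le` — `Σ_{x ∈ T} |F(s x)| ≤ C Z₄ / min(s,1)⁴` (`Z₄ = 81 Σ(k+1)⁻²`), `sum_abs_smul_tail_le` —
  `Σ_{x ∈ T, ‖x‖ > N} |F(s x)| ≤ C Z₄ / ((1 + s N) min(s,1)⁴)`;
* **`doubleSum_wrap_le`** — the pairs of `box L × box L` with `‖x − y‖ > L` (those for which the torus distance of the
  periodic lift differs from the `ℤ⁴` distance) contribute `≤ 2 C² Z₄² / ((1 + s L/2) min(s,1)⁸)` to
  `Σ |F(s x)| |G(s y)|` — negligible as `L → ∞` at fixed unit, which is all the X-stub's `∃ᶠ L` needs.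

HONEST FRAMING.  Elementary real analysis (folklore); nothing about Yang–Mills is asserted; one open stub of one open
gap-crux of a CONDITIONAL chain (Track A 0/28 UV); not a gap claim.
-/

set_option autoImplicit false

noncomputable section

open Filter Topology Finset
open scoped BigOperators
open Literature.MathematicalPhysics.QuantumLattice
open Literature.Probability.LatticeModels (Site box mem_box)
open Summit.QuantumFields.YangMills.Theorems.OSLegsFromFemtoAndGap (summable_inv_succ_sq mul_norm_le_norm_smul_siteToE)

namespace Summit.QuantumFields.YangMills.Cruxes.IR.AfOnset

/-! ## §5 Tails and wrap-around pairs -/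
section Tails

variable {F G : EuclideanSpace ℝ (Fin 4) → ℝ} {C : ℝ}

/-- **Schwartz weights of any unit** for a function with the cubic bound of order 10:
`Σ_{x ∈ T} |F(s x)| ≤ C Z₄ / min(s,1)⁴` (`Z₄ = 81 Σ(k+1)⁻²`). [folklore] -/
theorem sum_abs_smul_le (hC : 0 ≤ C)
    (hF : ∀ u : EuclideanSpace ℝ (Fin 4), |F u| ≤ C * |u 0| ^ 3 / (1 + ‖u‖) ^ 10)
    {s : ℝ} (hs : 0 < s) (T : Finset (Site 4)) :
    ∑ x ∈ T, |F (s • siteToE x)| ≤ C * (3 ^ 4 * ∑' k : ℕ, (((k : ℝ) + 1) ^ 2)⁻¹) / (min s 1) ^ 4 := by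
  have hmin : 0 < min s 1 := lt_min hs one_pos
  have hpt : ∀ x : Site 4, |F (s • siteToE x)| ≤ C * ((1 + s * ‖x‖) ^ 7)⁻¹ := by
    intro x
    set u : EuclideanSpace ℝ (Fin 4) := s • siteToE x with hu
    have h0 : |u 0| ≤ ‖u‖ := by simpa using PiLp.norm_apply_le u 0
    have h1 : |u 0| ≤ 1 + ‖u‖ := h0.trans (by linarith)
    have h2 : 1 + s * ‖x‖ ≤ 1 + ‖u‖ := by linarith [mul_norm_le_norm_smul_siteToE hs.le x]
    have h3 : |u 0| ^ 3 ≤ (1 + ‖u‖) ^ 3 := pow_le_pow_left₀ (abs_nonneg _) h1 3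
    calc |F u| ≤ C * |u 0| ^ 3 / (1 + ‖u‖) ^ 10 := hF u
      _ ≤ C * (1 + ‖u‖) ^ 3 / (1 + ‖u‖) ^ 10 := by gcongr
      _ = C * ((1 + ‖u‖) ^ 7)⁻¹ := by field_simp
      _ ≤ C * ((1 + s * ‖x‖) ^ 7)⁻¹ :=
          mul_le_mul_of_nonneg_left (inv_anti₀ (by positivity) (pow_le_pow_left₀ (by positivity) h2 7)) hC
  calc ∑ x ∈ T, |F (s • siteToE x)| ≤ ∑ x ∈ T, C * ((1 + s * ‖x‖) ^ 7)⁻¹ := Finset.sum_le_sum fun x _ => hpt x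
    _ = C * ∑ x ∈ T, ((1 + s * ‖x‖) ^ 7)⁻¹ := by rw [Finset.mul_sum]
    _ ≤ C * ((3 ^ 4 * ∑' k : ℕ, (((k : ℝ) + 1) ^ 2)⁻¹) / (min s 1) ^ 4) :=
        mul_le_mul_of_nonneg_left (sum_inv_pow_le_dim hs (by norm_num) T) hC
    _ = C * (3 ^ 4 * ∑' k : ℕ, (((k : ℝ) + 1) ^ 2)⁻¹) / (min s 1) ^ 4 := by ring

/-- **Schwartz tails of any unit**: `Σ_{x ∈ T, ‖x‖ > N} |F(s x)| ≤ C Z₄ / ((1 + s N) min(s,1)⁴)` for `N ≥ 0`.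
[folklore] -/
theorem sum_abs_smul_tail_le (hC : 0 ≤ C)
    (hF : ∀ u : EuclideanSpace ℝ (Fin 4), |F u| ≤ C * |u 0| ^ 3 / (1 + ‖u‖) ^ 10)
    {s : ℝ} (hs : 0 < s) {N : ℝ} (hN : 0 ≤ N) (T : Finset (Site 4)) :
    ∑ x ∈ T.filter (fun x => N < ‖x‖), |F (s • siteToE x)| ≤
      C * (3 ^ 4 * ∑' k : ℕ, (((k : ℝ) + 1) ^ 2)⁻¹) / ((1 + s * N) * (min s 1) ^ 4) := by
  have hmin : 0 < min s 1 := lt_min hs one_pos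
  have hsN : 0 < 1 + s * N := by positivity
  have hpt : ∀ x ∈ T.filter (fun x => N < ‖x‖),
      |F (s • siteToE x)| ≤ C / (1 + s * N) * ((1 + s * ‖x‖) ^ 6)⁻¹ := by
    intro x hx
    have hxN : N < ‖x‖ := (Finset.mem_filter.1 hx).2
    set u : EuclideanSpace ℝ (Fin 4) := s • siteToE x with hu
    have h0 : |u 0| ≤ ‖u‖ := by simpa using PiLp.norm_apply_le u 0
    have h1 : |u 0| ≤ 1 + ‖u‖ := h0.trans (by linarith)
    have h2 : 1 + s * ‖x‖ ≤ 1 + ‖u‖ := by linarith [mul_norm_le_norm_smul_siteToE hs.le x]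
    have h3 : |u 0| ^ 3 ≤ (1 + ‖u‖) ^ 3 := pow_le_pow_left₀ (abs_nonneg _) h1 3
    have h4 : 1 + s * N ≤ 1 + s * ‖x‖ := by nlinarith
    have h5 : (1 + s * N) * (1 + s * ‖x‖) ^ 6 ≤ (1 + ‖u‖) ^ 7 := by
      calc (1 + s * N) * (1 + s * ‖x‖) ^ 6 ≤ (1 + s * ‖x‖) * (1 + s * ‖x‖) ^ 6 :=
            mul_le_mul_of_nonneg_right h4 (by positivity)
        _ = (1 + s * ‖x‖) ^ 7 := by ring
        _ ≤ (1 + ‖u‖) ^ 7 := pow_le_pow_left₀ (by positivity) h2 7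
    calc |F u| ≤ C * |u 0| ^ 3 / (1 + ‖u‖) ^ 10 := hF u
      _ ≤ C * (1 + ‖u‖) ^ 3 / (1 + ‖u‖) ^ 10 := by gcongr
      _ = C / (1 + ‖u‖) ^ 7 := by field_simp
      _ ≤ C / ((1 + s * N) * (1 + s * ‖x‖) ^ 6) := div_le_div_of_nonneg_left hC (by positivity) h5
      _ = C / (1 + s * N) * ((1 + s * ‖x‖) ^ 6)⁻¹ := by field_simp
  calc ∑ x ∈ T.filter (fun x => N < ‖x‖), |F (s • siteToE x)|
      ≤ ∑ x ∈ T.filter (fun x => N < ‖x‖), C / (1 + s * N) * ((1 + s * ‖x‖) ^ 6)⁻¹ := Finset.sum_le_sum hpt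
    _ = C / (1 + s * N) * ∑ x ∈ T.filter (fun x => N < ‖x‖), ((1 + s * ‖x‖) ^ 6)⁻¹ := by rw [Finset.mul_sum]
    _ ≤ C / (1 + s * N) * ((3 ^ 4 * ∑' k : ℕ, (((k : ℝ) + 1) ^ 2)⁻¹) / (min s 1) ^ 4) :=
        mul_le_mul_of_nonneg_left (sum_inv_pow_le_dim hs (by norm_num) _) (by positivity)
    _ = C * (3 ^ 4 * ∑' k : ℕ, (((k : ℝ) + 1) ^ 2)⁻¹) / ((1 + s * N) * (min s 1) ^ 4) := by
        field_simp

/-- **The WRAP part of the double sum over the box** (pairs of `box L` with `‖x − y‖ > L`, where the torus distance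
differs from the `ℤ⁴` one): one of `x, y` has norm `> L/2`, so the Schwartz tails give
`≤ 2 C² Z₄² / ((1 + s L/2) min(s,1)⁸)` — small for `L` large at fixed unit `s`. [folklore] -/
theorem doubleSum_wrap_le (hC : 0 ≤ C)
    (hF : ∀ u : EuclideanSpace ℝ (Fin 4), |F u| ≤ C * |u 0| ^ 3 / (1 + ‖u‖) ^ 10)
    (hG : ∀ u : EuclideanSpace ℝ (Fin 4), |G u| ≤ C * |u 0| ^ 3 / (1 + ‖u‖) ^ 10)
    {s : ℝ} (hs : 0 < s) (L : ℕ) :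
    ∑ x ∈ box 4 L, ∑ y ∈ box 4 L,
        (if (L : ℝ) < ‖x - y‖ then |F (s • siteToE x)| * |G (s • siteToE y)| else 0) ≤
      2 * C ^ 2 * (3 ^ 4 * ∑' k : ℕ, (((k : ℝ) + 1) ^ 2)⁻¹) ^ 2 / ((1 + s * ((L : ℝ) / 2)) * (min s 1) ^ 8) := by
  classical
  set Z : ℝ := 3 ^ 4 * ∑' k : ℕ, (((k : ℝ) + 1) ^ 2)⁻¹ with hZ
  have hZ0 : 0 ≤ Z := riemann_const_nonneg 4
  have hmin : 0 < min s 1 := lt_min hs one_pos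
  have hL2 : (0 : ℝ) ≤ (L : ℝ) / 2 := by positivity
  -- termwise: one of the two points is far from the origin
  have hterm : ∀ x ∈ box 4 L, ∀ y ∈ box 4 L,
      (if (L : ℝ) < ‖x - y‖ then |F (s • siteToE x)| * |G (s • siteToE y)| else 0) ≤
        (if (L : ℝ) / 2 < ‖x‖ then |F (s • siteToE x)| else 0) * |G (s • siteToE y)| +
          |F (s • siteToE x)| * (if (L : ℝ) / 2 < ‖y‖ then |G (s • siteToE y)| else 0) := by
    intro x _ y _
    by_cases h : (L : ℝ) < ‖x - y‖
    · rw [if_pos h]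
      have hxy : ‖x - y‖ ≤ ‖x‖ + ‖y‖ := norm_sub_le x y
      by_cases hx : (L : ℝ) / 2 < ‖x‖
      · rw [if_pos hx]
        have : 0 ≤ |F (s • siteToE x)| * (if (L : ℝ) / 2 < ‖y‖ then |G (s • siteToE y)| else 0) := by
          split_ifs <;> positivity
        linarith
      · have hy : (L : ℝ) / 2 < ‖y‖ := by
          rw [not_lt] at hx; linarith
        rw [if_pos hy, if_neg hx, zero_mul, zero_add]
    · rw [if_neg h]
      have h1 : 0 ≤ (if (L : ℝ) / 2 < ‖x‖ then |F (s • siteToE x)| else 0) * |G (s • siteToE y)| := by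
        split_ifs <;> positivity
      have h2 : 0 ≤ |F (s • siteToE x)| * (if (L : ℝ) / 2 < ‖y‖ then |G (s • siteToE y)| else 0) := by
        split_ifs <;> positivity
      linarith
  have hFt := sum_abs_smul_tail_le hC hF hs hL2 (box 4 L)
  have hGt := sum_abs_smul_tail_le hC hG hs hL2 (box 4 L)
  have hFs := sum_abs_smul_le hC hF hs (box 4 L)
  have hGs := sum_abs_smul_le hC hG hs (box 4 L)
  rw [Finset.sum_filter] at hFt hGt
  have hFn : 0 ≤ ∑ x ∈ box 4 L, |F (s • siteToE x)| := Finset.sum_nonneg fun _ _ => abs_nonneg _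
  have hGtn : 0 ≤ ∑ y ∈ box 4 L, (if (L : ℝ) / 2 < ‖y‖ then |G (s • siteToE y)| else 0) :=
    Finset.sum_nonneg fun _ _ => by split_ifs <;> positivity
  calc ∑ x ∈ box 4 L, ∑ y ∈ box 4 L,
          (if (L : ℝ) < ‖x - y‖ then |F (s • siteToE x)| * |G (s • siteToE y)| else 0)
      ≤ ∑ x ∈ box 4 L, ∑ y ∈ box 4 L,
          ((if (L : ℝ) / 2 < ‖x‖ then |F (s • siteToE x)| else 0) * |G (s • siteToE y)| +
            |F (s • siteToE x)| * (if (L : ℝ) / 2 < ‖y‖ then |G (s • siteToE y)| else 0)) :=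
        Finset.sum_le_sum fun x hx => Finset.sum_le_sum fun y hy => hterm x hx y hy
    _ = (∑ x ∈ box 4 L, (if (L : ℝ) / 2 < ‖x‖ then |F (s • siteToE x)| else 0)) *
            (∑ y ∈ box 4 L, |G (s • siteToE y)|) +
          (∑ x ∈ box 4 L, |F (s • siteToE x)|) *
            (∑ y ∈ box 4 L, (if (L : ℝ) / 2 < ‖y‖ then |G (s • siteToE y)| else 0)) := by
        rw [Finset.sum_mul_sum, Finset.sum_mul_sum, ← Finset.sum_add_distrib]
        exact Finset.sum_congr rfl fun x _ => by rw [Finset.sum_add_distrib]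
    _ ≤ (C * Z / ((1 + s * ((L : ℝ) / 2)) * (min s 1) ^ 4)) * (C * Z / (min s 1) ^ 4) +
          (C * Z / (min s 1) ^ 4) * (C * Z / ((1 + s * ((L : ℝ) / 2)) * (min s 1) ^ 4)) := by
        gcongr
    _ = 2 * C ^ 2 * Z ^ 2 / ((1 + s * ((L : ℝ) / 2)) * (min s 1) ^ 8) := by
        field_simp
        ring

end Tails

end Summit.QuantumFields.YangMills.Cruxes.IR.AfOnset

end
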